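import Summits.QuantumFields.BalabanUV.Beta.GAN24.TopBorderKSlot
import Summits.QuantumFields.BalabanUV.Beta.GAN24.DilatedBorderThirdJet
import Summits.QuantumFields.BalabanUV.Beta.GAN24.StencilSlotVHRoot

/-!
# `BalabanUV.Beta.GAN24.TopBorderKSlotSymAt` (SYMMETRIC comb table AT THE IN-BLOCK ROOT; the corner-root base is leaf-05's `TopBorderKSlot`) — binder row G-an2-4 ∕ (CONV-C), road S3,
# **DIFF ROW R3-dVt (the TOP border piece, depth 0) RE-RUN FOR an2's ROOTED BORDER TABLE `DecLiftAdjoint.borderSum (Lc^j) (vhSAt (toSite r) d Lc)`** — «ROOTED-S3-V-DIFF» part (d)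
# ⇒ END **`diffVt_three_at`**: `∃ cVt θ, 0 ≤ θ < 1 ∧ ∀ r ∈ box (3+1) Lc, ∀ n κ′ u′, SupBound (member (n+3)'s unit-rescaled rooted TOP border piece − member (n+2)'s) (cVt·θ^{n+1})`,
# `θ` = the K-slot's own rate, constants BEFORE the root.  Consumer: the UNDRESSED top-aligned V pair of LENGTH 0 (`k = i+1`, births ≥ 1) of the born-V rate socket
# `BornBorderDriftThree.exists_hBdevV_three_of_supPairs`, through the owner's `BornBorderUndressedRow.lineage_v_top_pin_apply`.

NOT IN PRINT; OUR BOOKKEEPING (G-an2-4 formalisation swarm → CRUX TEAM (2), leaf prover `b2b-balaban-gan24-formalise-leaf-04`, gen 57; journal `CLAIMS.log` INTENT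
«ROOTED-S3-V-DIFF»).  [folklore] over tree names BY NAME: §1 the exact reduction «the rooted top border piece through the one-shot resolvent IS the step functional through
`KInvStep`» is the GENERIC `DilatedBorderThirdJet.e3OfS_borderSum_eq_e3K_dec` at dilation factor `Lc^j` (`Lc^{j+1} = Lc^j·Lc`; an1's rooted `locStencil_vhSAt` for its Fubini
hypothesis) — where the base used `DecLiftAdjoint.vertexOf_borderPiece`; §2 the units bookkeeping `e3K_KStepUnit_at` ∕ `unit_e3OfS_borderSum_top_at` = leaf-05's with `mfNeg ∘ vhS d Lc ↦
vhSAt (toSite r) d Lc` (both vanish on the ff ∕ mm blocks: `StencilSlotVHRoot.vhSAt_inl_inl` ∕ `vhSAt_inr_inr`); §3 the DIFF row from road P1's CLOSED K-slot (`ThirdJetKernel.supBound_e3K_step`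
under `KSlotAssembly.convCKWall_holds`), constant `|cVH|·Lc^{2(d+1)}·e3LipConst d C C (3ℓ²e^{4(d+1)Lcδ}) δ·cK` — the base's, root-free.  Base module untouched; `mmRead_pow_succ` not
needed.  0 `def`, 0 cited facts, 0 `def … : Prop`, 0 sorry; NO new estimate of Bałaban's.  HONEST FRAMING (cell contract, verbatim): «discharging `BetaPertH` makes Bałaban's UV
stability UNCONDITIONAL — a real constructive-QFT result; it is NOT the continuum limit and NOT the Clay problem.»  HONEST DEPENDENCY (verbatim): «continuum YM on T⁴ ⇐ BetaPertH ∧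
nine spine estimates (0/9 proved); BetaPertH ⇐ (D1) ∧ (D4) ∧ CAP+tail; G-an2-4 gates asym, D1 and NE2/3/4.»  Discharges NOTHING of «E3SupRate» ∕ (hS, hSall) ∕ hBdev by itself;
NEVER «G-an2-4 closed»; NOT D1, NOT BetaPertH, NOT continuum, NOT Clay.
Unit `b2b-balaban-gan24-formalise-leaf-04` (gen 57), 2026-08-21.
-/

noncomputable section

open Finset
open scoped BigOperators
open Literature.MathematicalPhysics.QuantumFieldTheory
open Literature.MathematicalPhysics.QuantumFieldTheory.Balaban1983to89
open Literature.MathematicalPhysics.QuantumFieldTheory.Balaban1983to89.Beta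
open ExpKernelCalculus (MKer)
open OneStepResolventKernel (Fib LocStencil KInv)
open OneStepKernelFamily (dec KInvStep)
open StepJetData (locStencil_smul)
open AveragingHessianKernels (ell)
open AveragingHessianKernelsRooted (vhSAt locStencil_vhSAt)
open AffineAveraging (box toSite)
open DecLiftAdjoint (borderSum)
open Summit.QuantumFields.BalabanUV.Beta.HessKerDressedUnits (unitK unitS unitS_apply legScale_inl legScale_inr)
open Summit.QuantumFields.BalabanUV.Beta.GAN24.CombesThomas (SupBound UnitDecayK CauchyDecayK KStepUnit sfStep smStep sfStep_ne_zero smStep_ne_zero)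
open Summit.QuantumFields.BalabanUV.Beta.GAN24.E3UnitSplit (e3OfS)
open Summit.QuantumFields.BalabanUV.Beta.GAN24.ThirdJetKernel (e3K e3K_smul e3K_unit e3LipConst supBound_e3K_step)
open Summit.QuantumFields.BalabanUV.Beta.GAN24.KSlotAssembly (convCKWall_holds)
open Summit.QuantumFields.BalabanUV.Beta.GAN24.StencilSlotVHRoot (vhSAt_inl_inl vhSAt_inr_inr)
open Summit.QuantumFields.BalabanUV.Beta.GAN24.DilatedBorderThirdJet (e3OfS_borderSum_eq_e3K_dec)

namespace Summit.QuantumFields.BalabanUV.Beta.GAN24.TopBorderKSlotSymAt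

variable {d : ℕ} {Lc : ℕ} [NeZero Lc]

/-! ## §1 The exact reduction at the root: the rooted top border piece through the one-shot resolvent IS the step functional through `KInvStep` -/

/-- [folklore] **THE ROOTED TOP BORDER PIECE THROUGH THE ONE-SHOT RESOLVENT IS THE STEP FUNCTIONAL THROUGH THE DECIMATED RESOLVENT** (exact, entrywise;
every in-block root): for member `j+1` (`N = Lc^{j+1}`, `M = Lc^j`) and any weight `c`,
`e3OfS N ((c·M^{d+2}) • borderSum M (vhSAt ρ)) κ′ u′ = e3K (KInvStep Lc j) Lc ((c·M^{d+2}·M^{d+2}) • vhSAt ρ) κ′ u′`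
— the generic `e3OfS_borderSum_eq_e3K_dec` at dilation factor `M = Lc^j` (`dec M (KInv N) = KInvStep Lc j` by `rfl`). -/
theorem e3OfS_borderSum_top_at (hLc : 1 ≤ Lc) {r : Fin (d + 1) → ℕ} (hr : r ∈ box (d + 1) Lc) (c : ℝ) (j : ℕ) (κ' : Fin (d + 1))
    (u' : Fin (d + 1) → ℤ) :
    e3OfS (Lc ^ (j + 1)) (fun κ u => (c * ((Lc : ℝ) ^ j) ^ (d + 2)) • borderSum (Lc ^ j) (fun κ₀ z₀ => vhSAt (toSite r) d Lc rfl κ₀ z₀) κ u) κ' u' =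
      e3K (KInvStep (d := d) Lc j) Lc
        (fun κ u => (c * ((Lc : ℝ) ^ j) ^ (d + 2) * ((Lc : ℝ) ^ j) ^ (d + 2)) • vhSAt (toSite r) d Lc rfl κ u) κ' u' := by
  have h := e3OfS_borderSum_eq_e3K_dec (Lc := Lc ^ j) (N := Lc) (N' := Lc ^ (j + 1)) (d := d) (pow_succ Lc j)
    (locStencil_vhSAt (d := d) hLc hr zero_le_one) one_pos (c * ((Lc : ℝ) ^ j) ^ (d + 2)) κ' u'
  rw [Nat.cast_pow] at h
  exact h

/-! ## §2 Units bookkeeping (leaf-05's, with the rooted table) -/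

omit [NeZero Lc] in
/-- [folklore] **THE ADOPTED UNITS RESTORE THE WEIGHT-ONE TABLE**: for the off-diagonal rooted (V-H) family (`vhSAt ρ` has `rfl`-zero ff∕mm blocks)
`unitS s_f s_m ((s_f·s_m)² • vhSAt ρ) = vhSAt ρ` (nonzero units). -/
theorem unitS_smul_sq_vhSAt {sf sm : ℝ} (hsf : sf ≠ 0) (hsm : sm ≠ 0) (ρ : Fin (d + 1) → ℤ) :
    unitS sf sm (fun κ u => ((sf * sm) ^ 2) • vhSAt ρ d Lc rfl κ u) = fun κ u => vhSAt ρ d Lc rfl κ u := by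
  funext κ u x y a b
  rw [unitS_apply]
  rcases a with α | μ <;> rcases b with β | ν
  · simp only [Pi.smul_apply, smul_eq_mul, vhSAt_inl_inl, mul_zero, zero_mul]
  · simp only [Pi.smul_apply, smul_eq_mul, legScale_inl, legScale_inr]
    field_simp
  · simp only [Pi.smul_apply, smul_eq_mul, legScale_inl, legScale_inr]
    field_simp
  · simp only [Pi.smul_apply, smul_eq_mul, vhSAt_inr_inr, mul_zero, zero_mul]

/-- [folklore] **THE STEP FUNCTIONAL THROUGH THE UNIT RESOLVENT vs THROUGH THE RAW ONE** (rooted table):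
`e3K K̃_j Lc (vhSAt ρ) = s_m(j)² · (s_f(j)·s_m(j))² · e3K (KInvStep Lc j) Lc (vhSAt ρ)` (`e3K_unit`, `unitS_smul_sq_vhSAt`, `e3K_smul`). -/
theorem e3K_KStepUnit_at (ρ : Fin (d + 1) → ℤ) (j : ℕ) (κ' : Fin (d + 1)) (u' : Fin (d + 1) → ℤ) (x z : Fin (d + 1) → ℤ) (a b : Fib d) :
    e3K (KStepUnit (d := d) Lc j) Lc (fun κ u => vhSAt ρ d Lc rfl κ u) κ' u' x z a b =
      smStep d Lc j ^ 2 * ((sfStep Lc j * smStep d Lc j) ^ 2 *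
        e3K (KInvStep (d := d) Lc j) Lc (fun κ u => vhSAt ρ d Lc rfl κ u) κ' u' x z a b) := by
  have hsf := sfStep_ne_zero (Lc := Lc) j
  have hsm := smStep_ne_zero (d := d) (Lc := Lc) j
  have h1 := e3K_unit hsf hsm (KInvStep (d := d) Lc j) Lc
    (fun κ u => ((sfStep Lc j * smStep d Lc j) ^ 2) • vhSAt ρ d Lc rfl κ u) κ' u'
  rw [unitS_smul_sq_vhSAt hsf hsm, e3K_smul] at h1
  show e3K (unitK (sfStep Lc j) (smStep d Lc j) (KInvStep (d := d) Lc j)) Lc (fun κ u => vhSAt ρ d Lc rfl κ u) κ' u' x z a b = _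
  rw [h1]
  simp only [Pi.smul_apply, smul_eq_mul]

/-- [folklore] **THE UNIT-RESCALED ROOTED TOP BORDER PIECE OF EVERY MEMBER IS ONE FIXED TRILINEAR FUNCTIONAL OF THE UNIT STEP RESOLVENT** against the FIXED
rooted one-step (V-H) table: for member `j+1` (`N = Lc^{j+1}`, `M = Lc^j`),
`N^{2(d+1)} · e3OfS N ((cVH·M^{d+2}) • borderSum M (vhSAt ρ)) κ′ u′ x z a b = cVH · Lc^{2(d+1)} · e3K K̃_j Lc (vhSAt ρ) κ′ u′ x z a b` — `n`-free prefactor. -/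
theorem unit_e3OfS_borderSum_top_at (hLc : 1 ≤ Lc) {r : Fin (d + 1) → ℕ} (hr : r ∈ box (d + 1) Lc) (cVH : ℝ) (j : ℕ) (κ' : Fin (d + 1))
    (u' : Fin (d + 1) → ℤ) (x z : Fin (d + 1) → ℤ) (a b : Fib d) :
    ((Lc : ℝ) ^ (j + 1)) ^ (2 * (d + 1)) *
        e3OfS (Lc ^ (j + 1)) (fun κ u => (cVH * ((Lc : ℝ) ^ j) ^ (d + 2)) • borderSum (Lc ^ j) (fun κ₀ z₀ => vhSAt (toSite r) d Lc rfl κ₀ z₀) κ u)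
          κ' u' x z a b =
      cVH * (Lc : ℝ) ^ (2 * (d + 1)) * e3K (KStepUnit (d := d) Lc j) Lc (fun κ u => vhSAt (toSite r) d Lc rfl κ u) κ' u' x z a b := by
  rw [e3OfS_borderSum_top_at hLc hr cVH j κ' u', e3K_smul, e3K_KStepUnit_at]
  simp only [Pi.smul_apply, smul_eq_mul, sfStep, smStep]
  ring

/-! ## §3 The DIFF row at the root from the K-slot; `d = 3` END -/

/-- **ROW R3-dVt AT THE IN-BLOCK ROOT AS A FUNCTION OF THE K-SLOT's UNIFORM DECAY AND CAUCHY RATE** (leaf-05's `diffVt_of_unitDecayK_cauchyDecayK` for the rooted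
symmetric table; NOT IN PRINT; [folklore] over the K-slot): `UnitDecayK … C δ`, `CauchyDecayK … cK θ δ`, `0 < δ`, `1 ≤ Lc` ⟹ at every in-block root the depth-0 one-step
DIFFERENCE of the unit-rescaled rooted top border pieces of members `n+3` ∕ `n+2` has sup norm `≤ cVt·θ^{n+1}`, `cVt = |cVH|·Lc^{2(d+1)}·e3LipConst d C C (3ℓ²e^{4(d+1)Lcδ}) δ·cK`
— SAME constant as the base, root-free; the rate `θ` IS the K-slot's.  Discharges NOTHING of «E3SupRate» by itself; NOT BetaPertH, NOT continuum, NOT Clay. -/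
theorem diffVt_of_unitDecayK_cauchyDecayK_at (hLc : 1 ≤ Lc) {C δ cK θ : ℝ} (hδ : 0 < δ)
    (hK : UnitDecayK d Lc (sfStep Lc) (smStep d Lc) C δ) (hKK : CauchyDecayK d Lc (sfStep Lc) (smStep d Lc) cK θ δ) (cVH : ℝ)
    {r : Fin (d + 1) → ℕ} (hr : r ∈ box (d + 1) Lc) :
    ∀ (n : ℕ) (κ' : Fin (d + 1)) (u' : Fin (d + 1) → ℤ), SupBound (fun x z a b =>
      ((Lc : ℝ) ^ (n + 1 + 1 + 1)) ^ (2 * (d + 1)) * e3OfS (Lc ^ (n + 1 + 1 + 1))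
          (fun κ u => (cVH * ((Lc : ℝ) ^ (n + 1 + 1)) ^ (d + 2)) • borderSum (Lc ^ (n + 1 + 1)) (fun κ₀ z₀ => vhSAt (toSite r) d Lc rfl κ₀ z₀) κ u)
          κ' u' x z a b -
        ((Lc : ℝ) ^ (n + 1 + 1)) ^ (2 * (d + 1)) * e3OfS (Lc ^ (n + 1 + 1))
          (fun κ u => (cVH * ((Lc : ℝ) ^ (n + 1)) ^ (d + 2)) • borderSum (Lc ^ (n + 1)) (fun κ₀ z₀ => vhSAt (toSite r) d Lc rfl κ₀ z₀) κ u)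
          κ' u' x z a b)
      (|cVH| * (Lc : ℝ) ^ (2 * (d + 1)) *
          (e3LipConst d C C (3 * (ell (d + 1) Lc : ℝ) ^ 2 * Real.exp (4 * ((d : ℝ) + 1) * Lc * δ)) δ * cK) * θ ^ (n + 1)) := by
  intro n κ' u' x z a b
  dsimp only
  have h := supBound_e3K_step hK hKK (locStencil_vhSAt (d := d) hLc hr hδ.le) hδ le_rfl hLc (n + 1) κ' u' x z a b
  rw [Pi.sub_apply] at h
  rw [unit_e3OfS_borderSum_top_at hLc hr cVH (n + 1 + 1) κ' u' x z a b, unit_e3OfS_borderSum_top_at hLc hr cVH (n + 1) κ' u' x z a b, ← mul_sub,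
    abs_mul, abs_mul, abs_of_nonneg (by positivity : (0 : ℝ) ≤ (Lc : ℝ) ^ (2 * (d + 1)))]
  calc |cVH| * (Lc : ℝ) ^ (2 * (d + 1)) *
        |e3K (KStepUnit (d := d) Lc (n + 1 + 1)) Lc (fun κ u => vhSAt (toSite r) d Lc rfl κ u) κ' u' x z a b -
          e3K (KStepUnit (d := d) Lc (n + 1)) Lc (fun κ u => vhSAt (toSite r) d Lc rfl κ u) κ' u' x z a b|
      ≤ |cVH| * (Lc : ℝ) ^ (2 * (d + 1)) *
          (e3LipConst d C C (3 * (ell (d + 1) Lc : ℝ) ^ 2 * Real.exp (4 * ((d : ℝ) + 1) * Lc * δ)) δ * cK * θ ^ (n + 1)) :=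
        mul_le_mul_of_nonneg_left h (by positivity)
    _ = _ := by ring

/-- **ROW R3-dVt AT `d = 3`, `Lc ≥ 2`, AT EVERY IN-BLOCK ROOT — UNCONDITIONAL** (constants BEFORE the root; `θ` = the K-slot's rate of road P1's CLOSED K-slot
`KSlotAssembly.convCKWall_holds`, `0 ≤ θ < 1`).  NOT IN PRINT; our bookkeeping.  The top-aligned UNDRESSED V PAIR of length 0 (`(i+2, i+1) − (i+1, i)`, births `i ≥ 1`) of the
born-V rate socket is `Lc^4 ×` this row through the owner's `lineage_v_top_pin_apply`; «E3SupRate» ∕ hBdev NOT discharged by it alone; NOT BetaPertH, NOT continuum, NOT Clay. -/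
theorem diffVt_three_at {Lc : ℕ} [NeZero Lc] (hLc : 2 ≤ Lc) (cVH : ℝ) :
    ∃ cVt θ : ℝ, 0 ≤ θ ∧ θ < 1 ∧ ∀ (r : Fin (3 + 1) → ℕ), r ∈ box (3 + 1) Lc → ∀ (n : ℕ) (κ' : Fin (3 + 1)) (u' : Fin (3 + 1) → ℤ),
      SupBound (fun x z a b =>
        ((Lc : ℝ) ^ (n + 1 + 1 + 1)) ^ (2 * (3 + 1)) * e3OfS (Lc ^ (n + 1 + 1 + 1))
            (fun κ u => (cVH * ((Lc : ℝ) ^ (n + 1 + 1)) ^ (3 + 2)) • borderSum (Lc ^ (n + 1 + 1)) (fun κ₀ z₀ => vhSAt (toSite r) 3 Lc rfl κ₀ z₀) κ u)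
            κ' u' x z a b -
          ((Lc : ℝ) ^ (n + 1 + 1)) ^ (2 * (3 + 1)) * e3OfS (Lc ^ (n + 1 + 1))
            (fun κ u => (cVH * ((Lc : ℝ) ^ (n + 1)) ^ (3 + 2)) • borderSum (Lc ^ (n + 1)) (fun κ₀ z₀ => vhSAt (toSite r) 3 Lc rfl κ₀ z₀) κ u)
            κ' u' x z a b)
        (cVt * θ ^ (n + 1)) := by
  obtain ⟨C, δ, cK, θ, hδ, hθ0, hθ1, hK, hKK⟩ := convCKWall_holds (Lc := Lc) hLc
  exact ⟨_, θ, hθ0, hθ1, fun r hr => diffVt_of_unitDecayK_cauchyDecayK_at (le_trans (by norm_num) hLc) hδ hK hKK cVH hr⟩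

end Summit.QuantumFields.BalabanUV.Beta.GAN24.TopBorderKSlotSymAt

end
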